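import Literature.NumberTheory.EllipticCurves.FormalGroupDictionaryNormedAlgebraProofs
import Literature.NumberTheory.EllipticCurves.FormalGroupLawPointwiseProofs
import HarnessLib

/-!
# The formal group law computes the chord on `E₁(L)` for a complete ultrametric normed
# `ℚ_p`-algebra `L` (Silverman AEC IV.1 / VII.2.2 at `L`-points; proofs only)

Trunk T-NT-EC (`Literature/NumberTheory/EllipticCurves`). Pure proof file (no definitions, no named
facts): the CHORD case of `FormalGroupLawPadicProofs.lean` (`F(z(P), z(Q)) = z(P + Q)` for
`P, Q ∈ E₁(ℚ_p)`) VERBATIM with the points taken in `E(L) = (V ⊗ L)(L)`, `L` a complete ultrametric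
normed `ℚ_p`-algebra field (`ℂ_p`), the series being those of `V/ℚ_p` (`p`-integral) evaluated by
`padicAlgEval₂ L` / `padicAlgEval L` (`PadicSeriesEvaluationNormedAlgebra.lean`), the dictionary
`w(z(P)) = −1/y(P)`, `i(z(P)) = z(−P)` at `L`-points being `FormalGroupDictionaryNormedAlgebraProofs`.
Only the chord with DISTINCT `x`-coordinates is treated (no tangent, no `2`-torsion: these need
the derivative dictionary and are not used by the consumer) — the case the squared theta relation
at generic pairs needs (second pointwise brick A2 of the existence of the canonical cyclotomic
`p`-adic height over a number field, `CanonicalPAdicHeightCyc.lean`).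

PROVED: the values at `(u, v)` (`‖u‖, ‖v‖ < 1`) of the formal slope, intercept, chord-cubic
coefficients, third root and group law (`padicAlgEval₂_formalSlope_mul_sub`, `…_formalIntercept`,
`…_formalChordDenom`, `…_formalChordNum`, `…_formalChordZ`, `…_formalGroupLaw`);
`chordDenom_ne_zero_alg`; and **`padicAlgEval₂_formalGroupLaw_of_X_ne`**: for affine
`P = (x₁, y₁)`, `Q = (x₂, y₂) ∈ E(L)` with `‖x₁‖, ‖x₂‖ > 1`, `x₁ ≠ x₂`: `‖x(P + Q)‖ > 1` and
`F(z(P), z(Q)) = z(P + Q)` (third intersection via the chart transfer of Mathlib's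
`addPolynomial_slope` and Vieta — the tree's `chord_vieta` over the field `L`).

## Sources

* J. H. Silverman, *The Arithmetic of Elliptic Curves*, 2nd ed. (2009), IV.1 pp. 115–118,
  III.2.3, VII.2.2.
-/

noncomputable section

open scoped Classical
open PowerSeries Literature.NumberTheory.EllipticCurves

namespace WeierstrassCurve

variable {p : ℕ} [Fact p.Prime] (V : WeierstrassCurve ℚ_[p]) [hV : V.IsIntegral ℤ_[p]]
  {L : Type*} [NontriviallyNormedField L] [NormedAlgebra ℚ_[p] L] [IsUltrametricDist L]
  [CompleteSpace L]

/-! ### Pointwise values at `(u, v)` in the open unit disc of `L` -/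

section Pointwise

omit hV in
/-- Inverses evaluate to inverses, two variables: `F·G = 1 ⇒ G(u,v) = F(u,v)⁻¹`.
[cite: BourbakiAlgebraII2003, Ch. IV §4 no. 3] -/
theorem _root_.Literature.NumberTheory.EllipticCurves.padicAlgEval₂_eq_inv_of_mul_eq_one
    {F G : MvPowerSeries (Fin 2) ℚ_[p]} (hF : IsPadicInt F) (hG : IsPadicInt G) (hFG : F * G = 1)
    {u v : L} (hu : ‖u‖ < 1) (hv : ‖v‖ < 1) :
    padicAlgEval₂ L G u v = (padicAlgEval₂ L F u v)⁻¹ := by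
  have h := padicAlgEval₂_mul hF hG hu hv
  rw [hFG, ← map_one (MvPowerSeries.C (σ := Fin 2) (R := ℚ_[p])), padicAlgEval₂_C, map_one] at h
  exact eq_inv_of_mul_eq_one_right h.symm

variable {V}
variable {u v : L} (hu : ‖u‖ < 1) (hv : ‖v‖ < 1)
include hu hv

/-- **Chord property at points**: `λ(u,v)·(v − u) = w(v) − w(u)`. [cite: SilvermanAEC2009, IV.1] -/
theorem padicAlgEval₂_formalSlope_mul_sub :
    padicAlgEval₂ L V.formalSlope u v * (v - u) =
      padicAlgEval L V.formalW v - padicAlgEval L V.formalW u := by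
  have h := congrArg (fun G => padicAlgEval₂ L G u v) V.formalSlope_mul_sub
  rwa [padicAlgEval₂_mul V.isPadicInt_formalSlope ((IsPadicInt.X 1).sub (IsPadicInt.X 0)) hu hv,
    padicAlgEval₂_sub (IsPadicInt.X 1) (IsPadicInt.X 0) hu hv, padicAlgEval₂_X, padicAlgEval₂_X,
    padicAlgEval₂_sub (V.isPadicInt_formalW.powerSeries_subst (IsPadicInt.X 1)
      (PowerSeries.HasSubst.X 1)) (V.isPadicInt_formalW.powerSeries_subst (IsPadicInt.X 0)
      (PowerSeries.HasSubst.X 0)) hu hv,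
    padicAlgEval₂_subst_X V.isPadicInt_formalW hu hv, padicAlgEval₂_subst_X V.isPadicInt_formalW hu hv]
    at h

/-- **Intercept at points**: `ν(u,v) = w(u) − λ(u,v)·u`. [cite: SilvermanAEC2009, IV.1] -/
theorem padicAlgEval₂_formalIntercept :
    padicAlgEval₂ L V.formalIntercept u v =
      padicAlgEval L V.formalW u - padicAlgEval₂ L V.formalSlope u v * u := by
  unfold formalIntercept
  rw [padicAlgEval₂_sub (V.isPadicInt_formalW.powerSeries_subst (IsPadicInt.X 0)
      (PowerSeries.HasSubst.X 0)) (V.isPadicInt_formalSlope.mul (IsPadicInt.X 0)) hu hv,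
    padicAlgEval₂_subst_X V.isPadicInt_formalW hu hv, padicAlgEval₂_mul V.isPadicInt_formalSlope
      (IsPadicInt.X 0) hu hv, padicAlgEval₂_X]
  rfl

/-- The denominator at points: `1 + a₂λ̂ + a₄λ̂² + a₆λ̂³` (coefficients of `V ⊗ L`).
[cite: SilvermanAEC2009, IV.1] -/
theorem padicAlgEval₂_formalChordDenom :
    padicAlgEval₂ L V.formalChordDenom u v = 1 + (V.baseChange L).a₂ * padicAlgEval₂ L V.formalSlope u v +
      (V.baseChange L).a₄ * padicAlgEval₂ L V.formalSlope u v ^ 2 +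
      (V.baseChange L).a₆ * padicAlgEval₂ L V.formalSlope u v ^ 3 := by
  obtain ⟨-, h₂, -, h₄, h₆⟩ := V.norm_coeffs_le_one
  have hl := V.isPadicInt_formalSlope
  unfold formalChordDenom
  rw [padicAlgEval₂_add ((IsPadicInt.one.add ((IsPadicInt.C h₂).mul hl)).add ((IsPadicInt.C h₄).mul
      (hl.pow 2))) ((IsPadicInt.C h₆).mul (hl.pow 3)) hu hv,
    padicAlgEval₂_add (IsPadicInt.one.add ((IsPadicInt.C h₂).mul hl)) ((IsPadicInt.C h₄).mul
      (hl.pow 2)) hu hv,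
    padicAlgEval₂_add IsPadicInt.one ((IsPadicInt.C h₂).mul hl) hu hv,
    padicAlgEval₂_mul (IsPadicInt.C h₂) hl hu hv, padicAlgEval₂_mul (IsPadicInt.C h₄) (hl.pow 2) hu hv,
    padicAlgEval₂_mul (IsPadicInt.C h₆) (hl.pow 3) hu hv, padicAlgEval₂_pow hl hu hv,
    padicAlgEval₂_pow hl hu hv, padicAlgEval₂_C, padicAlgEval₂_C, padicAlgEval₂_C,
    ← map_one (MvPowerSeries.C (σ := Fin 2) (R := ℚ_[p])), padicAlgEval₂_C, map_one]
  rfl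

/-- The numerator at points: `a₁λ̂ + a₂ν̂ + a₃λ̂² + 2a₄λ̂ν̂ + 3a₆λ̂²ν̂`. [cite: SilvermanAEC2009, IV.1] -/
theorem padicAlgEval₂_formalChordNum :
    padicAlgEval₂ L V.formalChordNum u v =
      (V.baseChange L).a₁ * padicAlgEval₂ L V.formalSlope u v +
      (V.baseChange L).a₂ * padicAlgEval₂ L V.formalIntercept u v +
      (V.baseChange L).a₃ * padicAlgEval₂ L V.formalSlope u v ^ 2 +
      2 * (V.baseChange L).a₄ * padicAlgEval₂ L V.formalSlope u v * padicAlgEval₂ L V.formalIntercept u v +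
      3 * (V.baseChange L).a₆ * padicAlgEval₂ L V.formalSlope u v ^ 2 *
        padicAlgEval₂ L V.formalIntercept u v := by
  obtain ⟨h₁, h₂, h₃, h₄, h₆⟩ := V.norm_coeffs_le_one
  have hl := V.isPadicInt_formalSlope
  have hn := V.isPadicInt_formalIntercept
  have h2 : IsPadicInt (2 : MvPowerSeries (Fin 2) ℚ_[p]) := by
    rw [show (2 : MvPowerSeries (Fin 2) ℚ_[p]) = 1 + 1 by norm_num]; exact IsPadicInt.one.add IsPadicInt.one
  have h3 : IsPadicInt (3 : MvPowerSeries (Fin 2) ℚ_[p]) := by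
    rw [show (3 : MvPowerSeries (Fin 2) ℚ_[p]) = 1 + 1 + 1 by norm_num]
    exact (IsPadicInt.one.add IsPadicInt.one).add IsPadicInt.one
  have e2 : padicAlgEval₂ L (2 : MvPowerSeries (Fin 2) ℚ_[p]) u v = 2 := by
    rw [show (2 : MvPowerSeries (Fin 2) ℚ_[p]) = MvPowerSeries.C 2 by rw [map_ofNat], padicAlgEval₂_C,
      map_ofNat]
  have e3 : padicAlgEval₂ L (3 : MvPowerSeries (Fin 2) ℚ_[p]) u v = 3 := by
    rw [show (3 : MvPowerSeries (Fin 2) ℚ_[p]) = MvPowerSeries.C 3 by rw [map_ofNat], padicAlgEval₂_C,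
      map_ofNat]
  have t1 := (IsPadicInt.C h₁).mul hl
  have t2 := (IsPadicInt.C h₂).mul hn
  have t3 := (IsPadicInt.C h₃).mul (hl.pow 2)
  have t4 := ((h2.mul (IsPadicInt.C h₄)).mul hl).mul hn
  have t5 := ((h3.mul (IsPadicInt.C h₆)).mul (hl.pow 2)).mul hn
  unfold formalChordNum
  rw [padicAlgEval₂_add (((t1.add t2).add t3).add t4) t5 hu hv,
    padicAlgEval₂_add ((t1.add t2).add t3) t4 hu hv, padicAlgEval₂_add (t1.add t2) t3 hu hv,
    padicAlgEval₂_add t1 t2 hu hv,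
    padicAlgEval₂_mul (IsPadicInt.C h₁) hl hu hv, padicAlgEval₂_mul (IsPadicInt.C h₂) hn hu hv,
    padicAlgEval₂_mul (IsPadicInt.C h₃) (hl.pow 2) hu hv,
    padicAlgEval₂_mul ((h2.mul (IsPadicInt.C h₄)).mul hl) hn hu hv,
    padicAlgEval₂_mul (h2.mul (IsPadicInt.C h₄)) hl hu hv, padicAlgEval₂_mul h2 (IsPadicInt.C h₄) hu hv,
    padicAlgEval₂_mul ((h3.mul (IsPadicInt.C h₆)).mul (hl.pow 2)) hn hu hv,
    padicAlgEval₂_mul (h3.mul (IsPadicInt.C h₆)) (hl.pow 2) hu hv,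
    padicAlgEval₂_mul h3 (IsPadicInt.C h₆) hu hv,
    padicAlgEval₂_pow hl hu hv, padicAlgEval₂_C, padicAlgEval₂_C, padicAlgEval₂_C, padicAlgEval₂_C,
    padicAlgEval₂_C, e2, e3]
  rfl

/-- **The third root at points**: `z₃(u,v) = −u − v − N̂/D̂`. [cite: SilvermanAEC2009, IV.1] -/
theorem padicAlgEval₂_formalChordZ :
    padicAlgEval₂ L V.formalChordZ u v =
      -u - v - padicAlgEval₂ L V.formalChordNum u v * (padicAlgEval₂ L V.formalChordDenom u v)⁻¹ := by
  have hD := V.isPadicInt_formalChordDenom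
  have hDi := V.isPadicInt_invOfUnit_formalChordDenom
  have hN := V.isPadicInt_formalChordNum
  have hmul : V.formalChordDenom * MvPowerSeries.invOfUnit V.formalChordDenom 1 = 1 :=
    MvPowerSeries.mul_invOfUnit _ 1 (by rw [constantCoeff_formalChordDenom, Units.val_one])
  unfold formalChordZ
  rw [padicAlgEval₂_sub ((IsPadicInt.X 0).neg.sub (IsPadicInt.X 1)) (hN.mul hDi) hu hv,
    padicAlgEval₂_sub (IsPadicInt.X 0).neg (IsPadicInt.X 1) hu hv,
    padicAlgEval₂_neg (IsPadicInt.X 0) hu hv, padicAlgEval₂_X, padicAlgEval₂_X,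
    padicAlgEval₂_mul hN hDi hu hv, padicAlgEval₂_eq_inv_of_mul_eq_one hD hDi hmul hu hv]
  rfl

/-- **The formal group law at points**: `F(u,v) = i(z₃(u,v))`. [cite: SilvermanAEC2009, IV.1] -/
theorem padicAlgEval₂_formalGroupLaw :
    padicAlgEval₂ L V.formalGroupLaw u v =
      padicAlgEval L V.formalNeg (padicAlgEval₂ L V.formalChordZ u v) := by
  unfold formalGroupLaw
  exact padicAlgEval₂_subst V.isPadicInt_formalNeg V.isPadicInt_formalChordZ
    V.constantCoeff_formalChordZ hu hv

omit [CompleteSpace L] in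
/-- The leading coefficient `1 + a₂λ̂ + a₄λ̂² + a₆λ̂³` does not vanish at points of the open unit
disc (`‖λ̂‖ < 1`). [cite: SilvermanAEC2009, IV.1] -/
theorem chordDenom_ne_zero_alg :
    1 + (V.baseChange L).a₂ * padicAlgEval₂ L V.formalSlope u v +
        (V.baseChange L).a₄ * padicAlgEval₂ L V.formalSlope u v ^ 2 +
        (V.baseChange L).a₆ * padicAlgEval₂ L V.formalSlope u v ^ 3 ≠ 0 := by
  obtain ⟨-, h₂, -, h₄, h₆⟩ := V.norm_coeffs_baseChange_le_one L
  have hL : ‖padicAlgEval₂ L V.formalSlope u v‖ < 1 :=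
    norm_padicAlgEval₂_lt_one V.isPadicInt_formalSlope V.constantCoeff_formalSlope hu hv
  set Λ := padicAlgEval₂ L V.formalSlope u v
  have hml : ∀ {a b : L}, ‖a‖ ≤ 1 → ‖b‖ < 1 → ‖a * b‖ < 1 := fun ha hb => by
    rw [norm_mul]; exact mul_lt_one_of_nonneg_of_lt_one_right ha (norm_nonneg _) hb
  have hal : ∀ {a b : L}, ‖a‖ < 1 → ‖b‖ < 1 → ‖a + b‖ < 1 := fun ha hb =>
    (IsUltrametricDist.norm_add_le_max _ _).trans_lt (max_lt ha hb)
  have hs : ‖(V.baseChange L).a₂ * Λ + (V.baseChange L).a₄ * Λ ^ 2 + (V.baseChange L).a₆ * Λ ^ 3‖ < 1 := by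
    refine hal (hal (hml h₂ hL) ?_) ?_
    · exact hml h₄ (by rw [norm_pow]; exact pow_lt_one₀ (norm_nonneg _) hL two_ne_zero)
    · exact hml h₆ (by rw [norm_pow]; exact pow_lt_one₀ (norm_nonneg _) hL three_ne_zero)
  intro h0
  have : (V.baseChange L).a₂ * Λ + (V.baseChange L).a₄ * Λ ^ 2 + (V.baseChange L).a₆ * Λ ^ 3 = -1 := by
    linear_combination h0
  rw [this, norm_neg, norm_one] at hs
  exact lt_irrefl _ hs

end Pointwise

/-! ### The chord: `F(z(P), z(Q)) = z(P + Q)` for `x(P) ≠ x(Q)` -/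

section Chord

omit hV [NormedAlgebra ℚ_[p] L] [IsUltrametricDist L] [CompleteSpace L] in
/-- The line relation in the two charts: `w = λz + ν` iff `νy = λx − 1` (`z = −x/y`, `w = −1/y`,
`y ≠ 0`). [folklore] -/
private theorem line_xy_iff_line_zw' {x y Λ N : L} (hy : y ≠ 0) :
    N * y = Λ * x - 1 ↔ -1 / y = Λ * (-x / y) + N := by
  constructor
  · intro h
    field_simp
    linear_combination -h
  · intro h
    field_simp at h
    linear_combination -h

variable {V}

/-- **The chord case: `‖x(P + Q)‖ > 1` and `F(z(P), z(Q)) = z(P + Q)`** for affine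
`P = (x₁, y₁)`, `Q = (x₂, y₂) ∈ E(L)` with `‖x₁‖, ‖x₂‖ > 1` and `x₁ ≠ x₂`, on a `p`-integral
`V/ℚ_p`. The third intersection `R` of the line `PQ` with `E`, read in the `(z,w)`-chart, is the
third root `z₃(z(P), z(Q))` of the chord cubic (chart transfer of Mathlib's `addPolynomial_slope` and
Vieta, the tree's `chord_vieta` over `L`), and `z(P + Q) = z(−R) = i(z(R))`.
[cite: SilvermanAEC2009, IV.1] [cite: SilvermanAEC2009, VII.2.2] -/
theorem padicAlgEval₂_formalGroupLaw_of_X_ne {x₁ y₁ x₂ y₂ : L}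
    (h₁ : (V.baseChange L).toAffine.Nonsingular x₁ y₁) (h₂ : (V.baseChange L).toAffine.Nonsingular x₂ y₂)
    (hx₁ : 1 < ‖x₁‖) (hx₂ : 1 < ‖x₂‖) (hx : x₁ ≠ x₂) :
    1 < ‖(V.baseChange L).toAffine.addX x₁ x₂ ((V.baseChange L).toAffine.slope x₁ x₂ y₁ y₂)‖ ∧
      padicAlgEval₂ L V.formalGroupLaw (-x₁ / y₁) (-x₂ / y₂) =
        -((V.baseChange L).toAffine.addX x₁ x₂ ((V.baseChange L).toAffine.slope x₁ x₂ y₁ y₂)) /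
          (V.baseChange L).toAffine.addY x₁ x₂ y₁ ((V.baseChange L).toAffine.slope x₁ x₂ y₁ y₂) := by
  haveI : CharZero L := charZero_of_injective_algebraMap (algebraMap ℚ_[p] L).injective
  set A := V.baseChange L with hA
  have hxy : ¬(x₁ = x₂ ∧ y₁ = A.toAffine.negY x₂ y₂) := fun h => hx h.1
  obtain ⟨hy₁, hu0, hu1, -, -⟩ := V.param_facts_alg h₁.1 hx₁
  obtain ⟨hy₂, hv0, hv1, -, -⟩ := V.param_facts_alg h₂.1 hx₂
  set u : L := -x₁ / y₁ with hudef
  set v : L := -x₂ / y₂ with hvdef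
  set Λ := padicAlgEval₂ L V.formalSlope u v with hLdef
  set N := padicAlgEval₂ L V.formalIntercept u v with hNdef
  have hwu : padicAlgEval L V.formalW u = -1 / y₁ := V.padicAlgEval_formalW_eq h₁.1 hx₁
  have hwv : padicAlgEval L V.formalW v = -1 / y₂ := V.padicAlgEval_formalW_eq h₂.1 hx₂
  have hN : N = -1 / y₁ - Λ * u := by rw [hNdef, padicAlgEval₂_formalIntercept hu1 hv1, hwu]
  have hchord : Λ * (v - u) = -1 / y₂ - -1 / y₁ := by
    rw [← hwu, ← hwv]; exact padicAlgEval₂_formalSlope_mul_sub hu1 hv1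
  -- both points lie on the `(z,w)`-line `w = Λz + N`
  have hPw : -1 / y₁ = Λ * u + N := by rw [hN]; ring
  have hQw : -1 / y₂ = Λ * v + N := by rw [hN]; linear_combination -hchord
  have hP : N * y₁ = Λ * x₁ - 1 := (line_xy_iff_line_zw' hy₁).mpr hPw
  have hQ : N * y₂ = Λ * x₂ - 1 := (line_xy_iff_line_zw' hy₂).mpr hQw
  have hc3 := chordDenom_ne_zero_alg (V := V) hu1 hv1
  rw [← hLdef] at hc3
  -- the slope of the `(x,y)`-line is `Λ/N` (chord: `x₁ ≠ x₂`)
  have key : N * (y₁ - y₂) = Λ * (x₁ - x₂) := by linear_combination hP - hQ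
  have hN0 : N ≠ 0 := by
    intro h0
    rw [h0, zero_mul] at key
    have hL0 : Λ = 0 := (mul_eq_zero.mp key.symm).resolve_right (sub_ne_zero.mpr hx)
    rw [h0, hL0, zero_mul, zero_mul, zero_sub] at hP
    exact one_ne_zero (neg_eq_zero.mp hP.symm)
  have hslope : A.toAffine.slope x₁ x₂ y₁ y₂ = Λ / N := by
    rw [Affine.slope_of_X_ne hx]
    field_simp
    linear_combination key
  -- Mathlib's third intersection `R = (x₃, y₃)` and the chord factorisation
  set ℓ := A.toAffine.slope x₁ x₂ y₁ y₂ with hℓ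
  set x₃ := A.toAffine.addX x₁ x₂ ℓ with hx₃
  set y₃ := A.toAffine.negAddY x₁ x₂ y₁ ℓ with hy₃def
  have heq₃ : A.toAffine.Equation x₃ y₃ := Affine.equation_negAdd h₁.1 h₂.1 hxy
  have hfac : ∀ X : L,
      (Λ / N * (X - x₁) + y₁) ^ 2 + A.a₁ * X * (Λ / N * (X - x₁) + y₁) +
          A.a₃ * (Λ / N * (X - x₁) + y₁) - (X ^ 3 + A.a₂ * X ^ 2 + A.a₄ * X + A.a₆) =
        -((X - x₁) * (X - x₂) * (X - x₃)) := by
    intro X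
    have h := congrArg (Polynomial.eval X) (Affine.addPolynomial_slope h₁.1 h₂.1 hxy)
    rw [Affine.addPolynomial_eq] at h
    simp only [Cubic.toPoly, Polynomial.eval_neg, Polynomial.eval_add, Polynomial.eval_mul,
      Polynomial.eval_pow, Polynomial.eval_C, Polynomial.eval_X, Polynomial.eval_sub] at h
    rw [← hℓ, ← hx₃, hslope] at h
    linear_combination h
  have hR : N * y₃ = Λ * x₃ - 1 := by
    have : y₃ = ℓ * (x₃ - x₁) + y₁ := by rw [hy₃def]; rfl
    rw [this, hslope]
    field_simp
    linear_combination hP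
  have hy₃ : y₃ ≠ 0 := A.y_ne_zero_of_chord_coeff_ne_zero hN0 hP hR hfac hc3
  have hvieta := A.chord_vieta hN0 hy₁ hy₂ hy₃ hP hQ hR hfac
  -- the third root is `z(R)`
  have hz3 : padicAlgEval₂ L V.formalChordZ u v = -x₃ / y₃ := by
    rw [padicAlgEval₂_formalChordZ hu1 hv1, padicAlgEval₂_formalChordNum hu1 hv1,
      padicAlgEval₂_formalChordDenom hu1 hv1, ← hLdef, ← hNdef, hudef, hvdef, ← div_eq_mul_inv]
    have h' : -x₁ / y₁ + -x₂ / y₂ + -x₃ / y₃ =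
        -(A.a₁ * Λ + A.a₂ * N + A.a₃ * Λ ^ 2 + 2 * A.a₄ * Λ * N + 3 * A.a₆ * Λ ^ 2 * N) /
          (1 + A.a₂ * Λ + A.a₄ * Λ ^ 2 + A.a₆ * Λ ^ 3) := by
      rw [eq_div_iff hc3]; linear_combination hvieta
    linear_combination -h'
  -- `R ∈ E₁(L)`
  have hz3n : ‖padicAlgEval₂ L V.formalChordZ u v‖ < 1 :=
    norm_padicAlgEval₂_lt_one V.isPadicInt_formalChordZ V.constantCoeff_formalChordZ hu1 hv1
  have hNn : ‖N‖ < 1 :=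
    norm_padicAlgEval₂_lt_one V.isPadicInt_formalIntercept V.constantCoeff_formalIntercept hu1 hv1
  have hLn : ‖Λ‖ ≤ 1 := norm_padicAlgEval₂_le_one V.isPadicInt_formalSlope hu1 hv1
  have hwR : -1 / y₃ = Λ * (-x₃ / y₃) + N := (line_xy_iff_line_zw' hy₃).mp hR
  have hy₃n : 1 < ‖y₃‖ := by
    have h : ‖-1 / y₃‖ < 1 := by
      rw [hwR, ← hz3]
      refine (IsUltrametricDist.norm_add_le_max _ _).trans_lt (max_lt ?_ hNn)
      rw [norm_mul]; exact mul_lt_one_of_nonneg_of_lt_one_right hLn (norm_nonneg _) hz3n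
    rw [norm_div, norm_neg, norm_one, div_lt_one (norm_pos_iff.mpr hy₃)] at h
    exact h
  have hx₃n : 1 < ‖x₃‖ := V.one_lt_norm_x_of_one_lt_norm_y_alg heq₃ hy₃n
  -- conclusion
  refine ⟨hx₃n, ?_⟩
  show padicAlgEval₂ L V.formalGroupLaw u v = -(A.toAffine.addX x₁ x₂ ℓ) / A.toAffine.addY x₁ x₂ y₁ ℓ
  rw [padicAlgEval₂_formalGroupLaw hu1 hv1, hz3, V.padicAlgEval_formalNeg_eq heq₃ hx₃n]
  rfl

/-- **`F(z(P), z(Q)) = z(P + Q)` in coordinates**: if `P + Q = (x₃, y₃)` in `E(L)` (Mathlib's group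
law) for affine `P = (x₁, y₁)`, `Q = (x₂, y₂)` with `‖x₁‖, ‖x₂‖ > 1`, `x₁ ≠ x₂`, then `‖x₃‖ > 1` and
`F(−x₁/y₁, −x₂/y₂) = −x₃/y₃`. [cite: SilvermanAEC2009, VII.2.2] -/
theorem padicAlgEval₂_formalGroupLaw_of_add_eq {x₁ y₁ x₂ y₂ x₃ y₃ : L}
    (h₁ : (V.baseChange L).toAffine.Nonsingular x₁ y₁) (h₂ : (V.baseChange L).toAffine.Nonsingular x₂ y₂)
    (h₃ : (V.baseChange L).toAffine.Nonsingular x₃ y₃)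
    (hS : (.some x₁ y₁ h₁ : (V.baseChange L).toAffine.Point) + .some x₂ y₂ h₂ = .some x₃ y₃ h₃)
    (hx₁ : 1 < ‖x₁‖) (hx₂ : 1 < ‖x₂‖) (hx : x₁ ≠ x₂) :
    1 < ‖x₃‖ ∧ padicAlgEval₂ L V.formalGroupLaw (-x₁ / y₁) (-x₂ / y₂) = -x₃ / y₃ := by
  have hxy : ¬(x₁ = x₂ ∧ y₁ = (V.baseChange L).toAffine.negY x₂ y₂) := fun h => hx h.1
  rw [Affine.Point.add_some hxy] at hS
  obtain ⟨hX, hY⟩ := (Affine.Point.some.injEq _ _ _ _ _ _).mp hS |> fun h => (⟨h.1, h.2⟩ : _ ∧ _)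
  obtain ⟨hn, hF⟩ := padicAlgEval₂_formalGroupLaw_of_X_ne (V := V) h₁ h₂ hx₁ hx₂ hx
  rw [hX] at hn
  rw [hX, hY] at hF
  exact ⟨hn, hF⟩

end Chord

end WeierstrassCurve

end
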